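import Literature.AlgebraicGeometry.Resolution.HasseSchmidtTransverseOrder
import Literature.AlgebraicGeometry.Resolution.AffineBlowupAlgebra
import HarnessLib

/-!
# Hasse–Schmidt derivations along an affine blow-up chart: the transverse parameter stays transverse
  (every characteristic)

Topic: `Literature/AlgebraicGeometry/Resolution`. Companion of `HasseSchmidtTransverseOrder.lean` (the
one-point order transfer `J ⊆ 𝔪^b ⟺ J♯ ⊆ 𝔪^{b!} + (u)` to a regular hypersurface `W = V(u)` carrying a
Hasse–Schmidt derivation `D` with `D_1 u` a unit; [BGV12] Prop. 6.9) and the characteristic-free twin of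
`TransverseDerivationBlowup.lean` (which does the same for ONE derivation `δ`, enough in characteristic zero).

For a Hasse–Schmidt derivation `D = (D_n)` of `A/R` and `a ∈ A`:

* `HasseSchmidtDerivation.rescale` — **`(a^n D_n)_n` is again a Hasse–Schmidt derivation** (`a^{i+j} = a^i a^j`
  in the Leibniz rule);
* `HasseSchmidtDerivation.awayRescale_op_mem_blowupAlgebra`, `….exists_hasseSchmidtDerivation_blowupAlgebra` —
  **`(a^n D_n)_n` extends to the affine blow-up algebra `A[I/a] ⊆ A[1/a]`** (`AffineBlowupAlgebra.lean`): the
  extension `E = D.awayRescale a` of `(a^n D_n)` to `A[1/a]` (`HasseSchmidtDerivation.localize`) preserves `A[I/a]`, because for a generator `x/a`, `x ∈ I`, the Leibniz rule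
  for `x = (x/a)·a` gives `a·E_n(x/a) = a^n D_n x − Σ_{i<n} E_i(x/a)·a^{n-i} D_{n-i}(a)`, whence by induction
  `E_n(x/a) = a^{n-1} D_n x − Σ_{i<n} E_i(x/a) a^{n-1-i} D_{n-i} a ∈ A[I/a]` — the elementwise form of Giraud's
  Lemma on the transforms of differential Rees algebras ([BGV12] Lemma 4.6, [EV]);
* `HasseSchmidtDerivation.transform_op_one` — on any `A`-algebra `S` in which `a` is a non-zero-divisor and which
  carries a Hasse–Schmidt derivation `D'` with `D'_1(r) = a D_1(r)` for `r ∈ A` (the chart algebra above), the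
  strict transform `u'` of `u` (`a u' = u`) satisfies **`D'_1(u') = D_1(u) − D_1(a)·u'`**, so
  `D'_1 u' ≡ D_1 u (mod u')` (`op_one_transform_sub_mem_span`) and **`D'_1 u'` is a unit in every local ring of
  `S` at a point of `V(u')`** if `D_1 u` was a unit (`isUnit_map_op_one_transform`);
* `HasseSchmidtDerivation.chart_le_pow_iff_sharp_le_sup` — consequently the order transfer of
  `HasseSchmidtTransverseOrder.lean` is available again at every point `𝔮 ∋ u'` of the chart whose local ring is
  regular: `J ⊆ 𝔪_𝔮^b ⟺ Σ_{i<b} (Diff^{≤ i} J)^{b!/(b-i)} ⊆ 𝔪_𝔮^{b!} + (u')`, with the localised `D'`;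
* `HasseSchmidtDerivation.exists_hasseSchmidtDerivation_blowupAlgebra_transform`,
  `….blowupAlgebra_le_pow_iff_sharp_le_sup` — the same assembled on `A[I/a]` itself for `u ∈ I`: the chart
  derivation `D'` with `D'_1(u/a) = D_1(u) − D_1(a)·(u/a)`, a unit in the local rings at the points of `V(u/a)`,
  and the order transfer there — i.e. the hypotheses (regular local ring, Hasse–Schmidt derivation, `D_1 u` a
  unit) REPRODUCE THEMSELVES under blowing up a centre `I ∋ u`, which is what an induction along a sequence of
  such blow-ups needs.

This is the persistence mechanism behind the LSB clause of Hironaka's Th. 3.10 ([Hironaka2017], UNREFEREED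
manuscript, adjudicated in the `pub-hironaka` repair cell — nothing of the manuscript is asserted here) and behind
[BGV12] §6 (the hypersurface of Prop. 6.9 keeps a transverse differential operator of order one along permissible
transformations): after blowing up a centre inside `W = V(u)`, on the chart `A[I/a]` (`a ∈ I`, `u ∈ I`) the strict
transform `W' = V(u/a)` again carries a Hasse–Schmidt derivation whose first component is a unit on `u/a`.  What is
NOT here: the comparison of `(J')♯` with the transform of `J♯` (the ideal-theoretic content of the LSB clause), sheaves,
the non-affine gluing.

## Sources

* A. Bravo, M. L. García-Escamilla, O. Villamayor U., arXiv:1107.1797, Lemma 4.6 (Giraud's Lemma) p. 15 and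
  Prop. 6.9 pp. 20–21 (held text). [BravoGarciaEscamillaVillamayor2012]
* H. Matsumura, *Commutative Ring Theory*, §27 (higher derivations, extension to localisations). [Matsumura1987]
* J. Włodarczyk, *Simple Hironaka resolution in characteristic zero*, Lemma 3.10.4 (the characteristic-zero
  persistence with one derivation, `TransverseDerivationBlowup.lean`). [Wlodarczyk2005]
-/

noncomputable section

open IsLocalRing IsLocalization

namespace Literature.AlgebraicGeometry.Resolution

namespace HasseSchmidtDerivation

universe u v w

variable {R : Type u} {A : Type v} [CommSemiring R] [CommRing A] [Algebra R A]
  (D : HasseSchmidtDerivation R A)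

/-! ### The Leibniz rule in degree one -/

/-- `D_1(f g) = f D_1 g + D_1 f · g`: the component `D_1` of a Hasse–Schmidt derivation is a derivation.
[cite: Matsumura1987, §27] -/
theorem op_one_mul (f g : A) : D.op 1 (f * g) = f * D.op 1 g + D.op 1 f * g := by
  rw [D.leibniz 1 f g, Finset.Nat.sum_antidiagonal_succ, Finset.Nat.antidiagonal_zero,
    Finset.sum_singleton]
  simp only [op_zero_apply, zero_add]

/-! ### Rescaling `D_n ↦ a^n D_n` -/

/-- **`(a^n D_n)_n` is a Hasse–Schmidt derivation** (the Leibniz rule is homogeneous: `a^{i+j} = a^i a^j`).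
[cite: BravoGarciaEscamillaVillamayor2012, Lemma 4.6 (Giraud's Lemma: transforms of differential Rees algebras)] -/
def rescale (a : A) : HasseSchmidtDerivation R A where
  op n := a ^ n • D.op n
  op_zero := by rw [pow_zero, one_smul, D.op_zero]
  leibniz n f g := by
    simp only [LinearMap.smul_apply, smul_eq_mul]
    rw [D.leibniz, Finset.mul_sum]
    refine Finset.sum_congr rfl fun p hp => ?_
    rw [Finset.mem_antidiagonal] at hp
    rw [← hp, pow_add]
    ring

/-- `(D.rescale a)_n f = a^n D_n f`. [folklore] -/
@[simp] theorem rescale_op_apply (a : A) (n : ℕ) (f : A) :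
    (D.rescale a).op n f = a ^ n * D.op n f := rfl

/-! ### An abstract chart: `D'_n = a^n D_n` on an `A`-algebra where `a` is a non-zero-divisor -/

section Chart

variable {S : Type w} [CommRing S] [Algebra A S] [Algebra R S] {a : A}
  (D' : HasseSchmidtDerivation R S)

/-- **The first component on a strict transform**: if `D'_1 r = a D_1 r` on `A`, `a` is a non-zero-divisor of
`S` and `a u' = u`, then `D'_1(u') = D_1(u) − D_1(a)·u'` (Leibniz for `u = a·u'`, cancel `a`).
[cite: Wlodarczyk2005, Lemma 3.10.4 (proof: c' = y^{-μ+|α|} σ^*(c))] -/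
theorem transform_op_one (ha : algebraMap A S a ∈ nonZeroDivisors S)
    (hD : ∀ r : A, D'.op 1 (algebraMap A S r) = algebraMap A S (a * D.op 1 r))
    {u : A} {u' : S} (hu : algebraMap A S a * u' = algebraMap A S u) :
    D'.op 1 u' = algebraMap A S (D.op 1 u) - algebraMap A S (D.op 1 a) * u' := by
  have h := congrArg (D'.op 1) hu
  rw [op_one_mul, hD a, hD u, map_mul, map_mul] at h
  refine (mul_cancel_left_mem_nonZeroDivisors ha).mp ?_
  rw [mul_sub]
  linear_combination h

/-- `D'_1(u') ≡ D_1(u) (mod u')`: the class of `D'_1 u'` on the strict transform `V(u')` is the pull-back of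
the class of `D_1 u` on `V(u)`. [cite: Wlodarczyk2005, Lemma 3.10.4] -/
theorem op_one_transform_sub_mem_span (ha : algebraMap A S a ∈ nonZeroDivisors S)
    (hD : ∀ r : A, D'.op 1 (algebraMap A S r) = algebraMap A S (a * D.op 1 r))
    {u : A} {u' : S} (hu : algebraMap A S a * u' = algebraMap A S u) :
    D'.op 1 u' - algebraMap A S (D.op 1 u) ∈ Ideal.span {u'} :=
  Ideal.mem_span_singleton'.mpr ⟨-algebraMap A S (D.op 1 a), by
    rw [D.transform_op_one D' ha hD hu]; ring⟩

/-- In a local ring, a unit minus an element of the maximal ideal is a unit (local copy of the helper of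
`PCyclicBoundaryType.lean`, to keep the imports small). [folklore] -/
private theorem isUnit_sub_of_mem_maximalIdeal_aux
    {T : Type*} [CommRing T] [IsLocalRing T] {x y : T} (hx : IsUnit x) (hy : y ∈ maximalIdeal T) :
    IsUnit (x - y) := by
  by_contra h
  have hxy : x - y ∈ maximalIdeal T := (mem_maximalIdeal _).mpr (mem_nonunits_iff.mpr h)
  have hx' : x ∈ maximalIdeal T := by simpa using Ideal.add_mem _ hxy hy
  exact mem_nonunits_iff.mp ((mem_maximalIdeal _).mp hx') hx

/-- **Transversality persists**: if `D_1 u` is a unit of `A`, then `D'_1 u'` is a unit in every local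
`S`-algebra `T` in which `u'` lands in the maximal ideal (the local rings of the chart at the points of the strict
transform `V(u')`). [cite: Wlodarczyk2005, Lemma 3.10.4]
[cite: BravoGarciaEscamillaVillamayor2012, Prop. 6.9 (the hypersurface keeps a transverse operator along permissible transformations)] -/
theorem isUnit_map_op_one_transform {T : Type*} [CommRing T] [IsLocalRing T] (φ : S →+* T)
    (ha : algebraMap A S a ∈ nonZeroDivisors S)
    (hD : ∀ r : A, D'.op 1 (algebraMap A S r) = algebraMap A S (a * D.op 1 r))
    {u : A} {u' : S} (hu : algebraMap A S a * u' = algebraMap A S u) (hDu : IsUnit (D.op 1 u))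
    (hu' : φ u' ∈ maximalIdeal T) : IsUnit (φ (D'.op 1 u')) := by
  rw [D.transform_op_one D' ha hD hu, map_sub, map_mul]
  exact isUnit_sub_of_mem_maximalIdeal_aux ((hDu.map (algebraMap A S)).map φ)
    (Ideal.mul_mem_left _ _ hu')

/-- **Order transfer on the chart** (`HasseSchmidtTransverseOrder` at a point of the strict transform): at a prime
`𝔮 ∋ u'` of `S` whose local ring `T = S_𝔮` is regular, for every ideal `J ⊆ T` and every `b`,
`J ⊆ 𝔪^b ⟺ Σ_{i<b} (Diff^{≤ i}_{T/R} J)^{b!/(b-i)} ⊆ 𝔪^{b!} + (u')` — with the Hasse–Schmidt derivation `D'`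
localised at `𝔮`, whose first component is a unit on `u'`.
[cite: BravoGarciaEscamillaVillamayor2012, Prop. 6.9]
[cite: Hironaka2017, Th. 3.10 (p. 10; unrefereed manuscript — the pointwise content at a point of a later stage, given the chart derivation)] -/
theorem chart_le_pow_iff_sharp_le_sup (ha : algebraMap A S a ∈ nonZeroDivisors S)
    (hD : ∀ r : A, D'.op 1 (algebraMap A S r) = algebraMap A S (a * D.op 1 r))
    {u : A} {u' : S} (hu : algebraMap A S a * u' = algebraMap A S u) (hDu : IsUnit (D.op 1 u))
    (𝔮 : Ideal S) [𝔮.IsPrime] (hu' : u' ∈ 𝔮) (T : Type*) [CommRing T] [Algebra S T]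
    [IsLocalization.AtPrime T 𝔮] [IsRegularLocalRing T] [Algebra R T] [IsScalarTower R S T]
    (J : Ideal T) (b : ℕ) :
    J ≤ maximalIdeal T ^ b ↔
      ∑ i ∈ Finset.range b, diffIdeal R i J ^ (b.factorial / (b - i)) ≤
        maximalIdeal T ^ b.factorial ⊔ Ideal.span {algebraMap S T u'} := by
  have hmem : algebraMap S T u' ∈ maximalIdeal T :=
    (IsLocalization.AtPrime.to_map_mem_maximal_iff T 𝔮 u').mpr hu'
  refine Ideal.le_pow_iff_sharp_le_sup R (D'.localize 𝔮.primeCompl T) hmem ?_ J b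
  rw [localize_op_algebraMap]
  exact D.isUnit_map_op_one_transform D' (algebraMap S T) ha hD hu hDu hmem

end Chart

/-! ### Existence on the affine blow-up algebra `A[I/a]` -/

section Blowup

variable (I : Ideal A) (a : A)

/-- **The Hasse–Schmidt derivation `(a^n D_n)_n` extended to `A[1/a]`.**
[cite: Matsumura1987, §27 (extension of higher derivations to localisations)] -/
def awayRescale : HasseSchmidtDerivation R (Localization.Away a) :=
  (D.rescale a).localize (Submonoid.powers a) (Localization.Away a)

/-- On `A`: `E_n(r) = a^n D_n(r)` for the extension `E = D.awayRescale a`. [folklore] -/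
@[simp] theorem awayRescale_op_algebraMap (n : ℕ) (r : A) :
    (D.awayRescale a).op n (algebraMap A (Localization.Away a) r) =
      algebraMap A (Localization.Away a) (a ^ n * D.op n r) := by
  rw [awayRescale, localize_op_algebraMap, rescale_op_apply]

/-- **The recursion for a generator `y = x/a` of `A[I/a]`**: from the Leibniz rule for `x = y·a`,
`E_{m+1}(y) = a^m D_{m+1}(x) − Σ_{i+j=m} E_i(y)·a^j D_{j+1}(a)` in `A[1/a]` (`a` is a unit there).
[cite: BravoGarciaEscamillaVillamayor2012, Lemma 4.6 (Giraud's Lemma)] -/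
theorem awayRescale_op_succ_div (x : A) (m : ℕ) :
    (D.awayRescale a).op (m + 1) (algebraMap A (Localization.Away a) x * Away.invSelf a) =
      algebraMap A (Localization.Away a) (a ^ m * D.op (m + 1) x) -
        ∑ p ∈ Finset.antidiagonal m,
          (D.awayRescale a).op p.1 (algebraMap A (Localization.Away a) x * Away.invSelf a) *
            algebraMap A (Localization.Away a) (a ^ p.2 * D.op (p.2 + 1) a) := by
  have hya := div_mul_algebraMap a x
  have h := congrArg ((D.awayRescale a).op (m + 1)) hya
  rw [(D.awayRescale a).leibniz, Finset.Nat.sum_antidiagonal_succ'] at h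
  simp only [op_zero_apply, awayRescale_op_algebraMap] at h
  -- `h : E_{m+1} y · a + Σ_p E_{p.1} y · a^{p.2+1} D_{p.2+1} a = a^{m+1} D_{m+1} x`
  have hu : IsUnit (algebraMap A (Localization.Away a) a) := IsLocalization.Away.algebraMap_isUnit a
  have hS : ∑ p ∈ Finset.antidiagonal m,
      (D.awayRescale a).op p.1 (algebraMap A (Localization.Away a) x * Away.invSelf a) *
          algebraMap A (Localization.Away a) (a ^ p.2 * D.op (p.2 + 1) a) *
        algebraMap A (Localization.Away a) a =
      ∑ p ∈ Finset.antidiagonal m,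
        (D.awayRescale a).op p.1 (algebraMap A (Localization.Away a) x * Away.invSelf a) *
          algebraMap A (Localization.Away a) (a ^ (p.2 + 1) * D.op (p.2 + 1) a) := by
    refine Finset.sum_congr rfl fun p _ => ?_
    rw [mul_assoc, ← map_mul, pow_succ, mul_right_comm]
  have hY : algebraMap A (Localization.Away a) (a ^ m * D.op (m + 1) x) *
      algebraMap A (Localization.Away a) a =
      algebraMap A (Localization.Away a) (a ^ (m + 1) * D.op (m + 1) x) := by
    rw [← map_mul, pow_succ, mul_right_comm]
  refine (hu.mul_left_inj).mp ?_
  rw [sub_mul, Finset.sum_mul, hS, hY, ← h]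
  ring

/-- **The extension of `(a^n D_n)_n` to `A[1/a]` preserves the affine blow-up algebra `A[I/a]`**: generators
`x/a` by strong induction on `n` (`awayRescale_op_succ_div`), sums by linearity, products by the Leibniz rule —
the elementwise form of Giraud's Lemma for the chart `A[I/a]`.
[cite: BravoGarciaEscamillaVillamayor2012, Lemma 4.6 (Giraud's Lemma)] -/
theorem awayRescale_op_mem_blowupAlgebra {y : Localization.Away a} (hy : y ∈ blowupAlgebra I a) :
    ∀ n : ℕ, (D.awayRescale a).op n y ∈ blowupAlgebra I a := by
  -- generators: all components up to `n`, by induction on `n`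
  have hgen : ∀ x ∈ I, ∀ n, ∀ i ≤ n,
      (D.awayRescale a).op i (algebraMap A (Localization.Away a) x * Away.invSelf a) ∈
        blowupAlgebra I a := by
    intro x hx n
    induction n with
    | zero =>
      intro i hi
      obtain rfl : i = 0 := Nat.le_zero.mp hi
      rw [op_zero_apply]
      exact div_mem_blowupAlgebra I a hx
    | succ m ih =>
      intro i hi
      rcases Nat.lt_or_eq_of_le hi with hlt | rfl
      · exact ih i (Nat.lt_succ_iff.mp hlt)
      · rw [awayRescale_op_succ_div]
        refine Subalgebra.sub_mem _ (Subalgebra.algebraMap_mem _ _)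
          (Subalgebra.sum_mem _ fun p hp => ?_)
        rw [Finset.mem_antidiagonal] at hp
        exact Subalgebra.mul_mem _ (ih p.1 (by omega)) (Subalgebra.algebraMap_mem _ _)
  induction hy using Algebra.adjoin_induction with
  | mem y hy =>
    obtain ⟨x, hx, rfl⟩ := hy
    exact fun n => hgen x hx n n le_rfl
  | algebraMap r =>
    intro n
    rw [awayRescale_op_algebraMap]
    exact Subalgebra.algebraMap_mem _ _
  | add y z _ _ hy hz =>
    intro n
    rw [map_add]
    exact Subalgebra.add_mem _ (hy n) (hz n)
  | mul y z _ _ hy hz =>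
    intro n
    rw [(D.awayRescale a).leibniz]
    exact Subalgebra.sum_mem _ fun p _ => Subalgebra.mul_mem _ (hy p.1) (hz p.2)

/-- **A Hasse–Schmidt derivation `D'` of the affine blow-up algebra `A[I/a]` with `D'_n(r) = a^n D_n(r)`**
(`r ∈ A`) exists, for every Hasse–Schmidt derivation `D` of `A/R` — every characteristic (it is the restriction
of `D.awayRescale a`); the one-derivation version (`D' r = a δ r`) is `exists_derivation_blowupAlgebra`.
[cite: BravoGarciaEscamillaVillamayor2012, Lemma 4.6 (Giraud's Lemma)]
[cite: Matsumura1987, §27] -/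
theorem exists_hasseSchmidtDerivation_blowupAlgebra :
    ∃ D' : HasseSchmidtDerivation R (blowupAlgebra I a),
      (∀ (n : ℕ) (y : blowupAlgebra I a),
        ((D'.op n y : blowupAlgebra I a) : Localization.Away a) = (D.awayRescale a).op n y) ∧
      ∀ (n : ℕ) (r : A), D'.op n (algebraMap A (blowupAlgebra I a) r) =
        algebraMap A (blowupAlgebra I a) (a ^ n * D.op n r) := by
  have hmem : ∀ (y : blowupAlgebra I a) (n : ℕ),
      (D.awayRescale a).op n (y : Localization.Away a) ∈ blowupAlgebra I a :=
    fun y n => D.awayRescale_op_mem_blowupAlgebra I a y.2 n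
  let opB : ℕ → (blowupAlgebra I a →ₗ[R] blowupAlgebra I a) := fun n =>
    { toFun := fun y => ⟨(D.awayRescale a).op n y, hmem y n⟩
      map_add' := fun y z => Subtype.ext (by simp)
      map_smul' := fun c y => Subtype.ext (by simp) }
  have hopB : ∀ (n : ℕ) (y : blowupAlgebra I a),
      ((opB n y : blowupAlgebra I a) : Localization.Away a) = (D.awayRescale a).op n y :=
    fun n y => rfl
  refine ⟨⟨opB, LinearMap.ext fun y => Subtype.ext ?_, fun n y z => Subtype.ext ?_⟩, hopB,
    fun n r => Subtype.ext ?_⟩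
  · rw [hopB, op_zero_apply, LinearMap.id_apply]
  · rw [hopB, Subalgebra.coe_mul, (D.awayRescale a).leibniz, AddSubmonoidClass.coe_finsetSum]
    simp only [Subalgebra.coe_mul, hopB]
  · rw [hopB, Subalgebra.coe_algebraMap, awayRescale_op_algebraMap, Subalgebra.coe_algebraMap]

/-- **The chart hypotheses are met by `A[I/a]`**: for `u ∈ I` with `D_1 u` a unit, the Hasse–Schmidt derivation
`D'` of `exists_hasseSchmidtDerivation_blowupAlgebra` satisfies `D'_1(u/a) = D_1(u) − D_1(a)·(u/a)`, hence
`D'_1(u/a)` is a unit in every local ring of `A[I/a]` at a point of the strict transform `V(u/a)`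
(`isUnit_map_op_one_transform` with `algebraMap_mem_nonZeroDivisors_blowupAlgebra`).
[cite: Wlodarczyk2005, Lemma 3.10.4]
[cite: BravoGarciaEscamillaVillamayor2012, Prop. 6.9] -/
theorem exists_hasseSchmidtDerivation_blowupAlgebra_transform {u : A} (hu : u ∈ I)
    (hDu : IsUnit (D.op 1 u)) :
    ∃ D' : HasseSchmidtDerivation R (blowupAlgebra I a),
      (∀ (n : ℕ) (r : A), D'.op n (algebraMap A (blowupAlgebra I a) r) =
        algebraMap A (blowupAlgebra I a) (a ^ n * D.op n r)) ∧
      D'.op 1 ⟨_, div_mem_blowupAlgebra I a hu⟩ =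
        algebraMap A (blowupAlgebra I a) (D.op 1 u) -
          algebraMap A (blowupAlgebra I a) (D.op 1 a) * ⟨_, div_mem_blowupAlgebra I a hu⟩ ∧
      ∀ (T : Type w) [CommRing T] [IsLocalRing T] (φ : blowupAlgebra I a →+* T),
        φ ⟨_, div_mem_blowupAlgebra I a hu⟩ ∈ maximalIdeal T →
          IsUnit (φ (D'.op 1 ⟨_, div_mem_blowupAlgebra I a hu⟩)) := by
  obtain ⟨D', -, hD'⟩ := D.exists_hasseSchmidtDerivation_blowupAlgebra I a
  have hD1 : ∀ r : A, D'.op 1 (algebraMap A (blowupAlgebra I a) r) =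
      algebraMap A (blowupAlgebra I a) (a * D.op 1 r) := fun r => by rw [hD' 1 r, pow_one]
  have hau : algebraMap A (blowupAlgebra I a) a * ⟨_, div_mem_blowupAlgebra I a hu⟩ =
      algebraMap A (blowupAlgebra I a) u := by
    refine Subtype.ext ?_
    change algebraMap A (Localization.Away a) a *
        (algebraMap A (Localization.Away a) u * Away.invSelf a) =
      algebraMap A (Localization.Away a) u
    rw [mul_comm, div_mul_algebraMap]
  exact ⟨D', hD', D.transform_op_one D' algebraMap_mem_nonZeroDivisors_blowupAlgebra hD1 hau,
    fun T _ _ φ hφ => D.isUnit_map_op_one_transform D' φ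
      algebraMap_mem_nonZeroDivisors_blowupAlgebra hD1 hau hDu hφ⟩

/-- **Order transfer at the points of the strict transform, next stage included**: for `u ∈ I` with `D_1 u`
a unit and a prime `𝔮 ∋ u/a` of `A[I/a]` with regular local ring `T = A[I/a]_𝔮`, the local ring carries a
Hasse–Schmidt derivation `D''` (the localisation of the chart derivation `D'`, `D'_n r = a^n D_n r`) whose first
component is a unit on `u/a`, and `J ⊆ 𝔪^b ⟺ Σ_{i<b} (Diff^{≤ i}_{T/R} J)^{b!/(b-i)} ⊆ 𝔪^{b!} + (u/a)` for all
`J`, `b` — so the hypotheses of `Ideal.le_pow_iff_sharp_le_sup` reproduce themselves along blow-ups with centre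
`I ∋ u` (every characteristic). [cite: BravoGarciaEscamillaVillamayor2012, Prop. 6.9]
[cite: Hironaka2017, Th. 3.10 (p. 10; unrefereed manuscript — pointwise content at a point of the first chart; the LSB clause itself is not asserted)] -/
theorem blowupAlgebra_le_pow_iff_sharp_le_sup {u : A} (hu : u ∈ I) (hDu : IsUnit (D.op 1 u))
    (𝔮 : Ideal (blowupAlgebra I a)) [𝔮.IsPrime]
    (hu' : (⟨_, div_mem_blowupAlgebra I a hu⟩ : blowupAlgebra I a) ∈ 𝔮)
    (T : Type w) [CommRing T] [Algebra (blowupAlgebra I a) T] [IsLocalization.AtPrime T 𝔮]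
    [IsRegularLocalRing T] [Algebra R T] [IsScalarTower R (blowupAlgebra I a) T] :
    ∃ D'' : HasseSchmidtDerivation R T,
      (∀ (n : ℕ) (r : A), D''.op n (algebraMap (blowupAlgebra I a) T (algebraMap A (blowupAlgebra I a) r)) =
        algebraMap (blowupAlgebra I a) T (algebraMap A (blowupAlgebra I a) (a ^ n * D.op n r))) ∧
      IsUnit (D''.op 1 (algebraMap (blowupAlgebra I a) T ⟨_, div_mem_blowupAlgebra I a hu⟩)) ∧
      ∀ (J : Ideal T) (b : ℕ), J ≤ maximalIdeal T ^ b ↔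
        ∑ i ∈ Finset.range b, diffIdeal R i J ^ (b.factorial / (b - i)) ≤
          maximalIdeal T ^ b.factorial ⊔
            Ideal.span {algebraMap (blowupAlgebra I a) T ⟨_, div_mem_blowupAlgebra I a hu⟩} := by
  obtain ⟨D', hD', -, hunit⟩ := D.exists_hasseSchmidtDerivation_blowupAlgebra_transform I a hu hDu
  have hmem : algebraMap (blowupAlgebra I a) T ⟨_, div_mem_blowupAlgebra I a hu⟩ ∈ maximalIdeal T :=
    (IsLocalization.AtPrime.to_map_mem_maximal_iff T 𝔮 _).mpr hu'
  have hU : IsUnit ((D'.localize 𝔮.primeCompl T).op 1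
      (algebraMap (blowupAlgebra I a) T ⟨_, div_mem_blowupAlgebra I a hu⟩)) := by
    rw [localize_op_algebraMap]
    exact hunit T (algebraMap _ T) hmem
  refine ⟨D'.localize 𝔮.primeCompl T, fun n r => ?_, hU, fun J b => ?_⟩
  · rw [localize_op_algebraMap, hD']
  · exact Ideal.le_pow_iff_sharp_le_sup R (D'.localize 𝔮.primeCompl T) hmem hU J b

end Blowup

end HasseSchmidtDerivation

end Literature.AlgebraicGeometry.Resolution
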